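import Summits.NavierStokesRegularity.NavierStokesRegularity.Theses.AxisymmetricExtremality
import Literature.Analysis.FluidPDE.NSBoundedHigherRegularityOfLemma61
import Literature.Analysis.FluidPDE.SereginEpsilonRegularityHigherHolds
import Literature.Analysis.FluidPDE.RusinSverakBackwardRegularity
import Literature.Analysis.FluidPDE.SereginSverakPressureDecayBalls
import Literature.Analysis.FluidPDE.SuitableWeakStability
import Literature.Analysis.FluidPDE.SuitableWeakRescaling
import HarnessLib

/-!
# Seregin 2022, §2 Step 4, last sentence: `C(R) → 0` at the origin makes the origin regular —
# crux stmt-NavierStokesRegularity-15453 (`AxisymmetricExtremality.AxisymmetricKatoGlobal`), line registered, support for stub `stub_sereginLogSwirlOrigin`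

Support file (`--supports stmt-NavierStokesRegularity-15453`; theorems only, everything proved)
toward the registered stub `stub_sereginLogSwirlOrigin`, which is verbatim the named fact
`Literature.Analysis.FluidPDE.seregin2022_logSwirl_regularAtOrigin` (G. Seregin, J. Math. Fluid
Mech. 24 (2022), Paper 27 = arXiv:2201.00153, §2).  Step 4 of that proof shows
(2.8) `R⁻² ∫_{Q(R)} |v̄|³ → 0` and `R⁻² ∫_{Q(R)} |v_θ|³ → 0` as `R → 0`, and concludes (arXiv p. 7,
last paragraph): "According to the partial regularity theory for the Navier–Stokes equations and
to (2.8), the origin `z = 0` is a regular point of `v`."  This file proves that concluding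
implication for the hypothesis block of the fact (Def. 1.1 in `Q = 𝒞 × ]-1, 0[`):

* `isRegularAtOrigin_of_tendsto_cubicC` — if `(v, q)` is a suitable weak solution on
  `SereginSverak2009.parCylOpens 0 1` with the global classes of Def. 1.1 and
  `SereginSverak2009.cubicC 0 R v → 0` as `R → 0⁺` (`C(R) = R⁻²∫_{Q(R)}|v|³` on the coordinate
  cylinders `Q(R) = 𝒞(R) × ]-R², 0[`), then `SereginSverak2009.IsRegularAtOrigin v`;
* `isSuitableWeakSolutionInBall_zero_of_parCyl` — the Def.-1.1 class restricts to
  Albritton–Barker's class `IsSuitableWeakSolutionInBall r 0 v q` on every ball cylinder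
  `Q_r(0)`, `0 < r ≤ 1`;
* `parabolicCylinder_zero_subset_parCyl` — `Q_r(0) ⊆ Q` for `0 < r ≤ 1`.

Proof ("the partial regularity theory", made explicit with proved inputs of the tree): the ball
functional is dominated by the cylinder one, `C_B(r) ≤ C_𝒞(r)` (`cknC_le_cubicC`), hence `≤ e`
for `0 < r ≤ r₀ ≤ 1/2`; the pressure decay estimate of Seregin–Šverák 2009, (as13)
(`seregin_sverak_pressure_decay_holds`, ratio form) iterated along the scales `θʲ r₀` with
`c θ ≤ 1/2` (`cknD_iterate_le_of_pressure_decay`, `exists_ratio_mul_le_half`) gives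
`D(θᴶr₀) ≤ 2^{-J} D(r₀) + 2cθ⁻²e`, small for `J` large (`D(r₀) ≤ r₀⁻²∫_Q|q|^{3/2} < ∞`) and `e`
small; so `C(s) + D(s) < ε₀` at `s = θᴶr₀`, and Seregin 2014, Lemma 6.1 at scale `s`
(`seregin2014_lemma61_holds` through `exists_smooth_representative_of_small`) yields a bounded
smooth representative of `v` on `Q_{s/2}(0)`, whence `v ∈ L_∞(Q(s/4))` since
`Q(s/4) ⊆ Q_{√2 s/4}(0) ⊆ Q_{s/2}(0)` (`parCyl_subset_parabolicCylinder`).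

## References

* G. Seregin, J. Math. Fluid Mech. 24 (2022), Paper No. 27 = arXiv:2201.00153, §2 Step 4 (arXiv
  p. 7), Def. 1.1. [`Seregin2022LocalAxisym`]
* G. Seregin, V. Šverák, Comm. PDE 34 (2009) = arXiv:0804.1803, proof of Lemma 3.5, (as13).
  [`SereginSverak2009`]
* G. Seregin, *Lecture notes on regularity theory for the Navier–Stokes equations* (2014), Ch. 6,
  Lemma 6.1. [`Seregin2014`]
-/

noncomputable section

open Set MeasureTheory Filter Topology Function Metric
open scoped ENNReal NNReal
open Literature.Analysis.FluidPDE

-- `<Problem> = <Summit>` duplicates a namespace component by design (lakefile sets the same option).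
set_option linter.dupNamespace false

namespace Summit.NavierStokesRegularity.NavierStokesRegularity.Theorems.AxisymmetricKatoGlobal.EulerScaling

/-- For `0 < r ≤ 1`, the ball cylinder `Q_r(0)` lies in Seregin's `Q = 𝒞 × ]-1, 0[`. [folklore] -/
theorem parabolicCylinder_zero_subset_parCyl {r : ℝ} (hr : 0 < r) (hr1 : r ≤ 1) :
    parabolicCylinder r (0 : ℝ × EuclideanSpace ℝ (Fin 3)) ⊆ SereginSverak2009.parCyl 0 1 :=
  (parabolicCylinder_subset_parCyl 0 r).trans (SereginSverak2009.parCyl_mono 0 hr.le hr1)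

/-- **The Def.-1.1 class restricts to Albritton–Barker's class on every ball cylinder `Q_r(0)`,
`0 < r ≤ 1`** (the passage used implicitly when "the partial regularity theory" is applied at
the origin). [cite: Seregin2022LocalAxisym, Def. 1.1 and §2 Step 4 (arXiv:2201.00153 p. 7)] -/
theorem isSuitableWeakSolutionInBall_zero_of_parCyl
    {v : ℝ → EuclideanSpace ℝ (Fin 3) → EuclideanSpace ℝ (Fin 3)} {q : ℝ → EuclideanSpace ℝ (Fin 3) → ℝ}
    (hsw : IsSuitableWeakSolutionOn (SereginSverak2009.parCylOpens 0 1) 1 0 v q)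
    (hA : ∃ C : ℝ≥0, ∀ᵐ t ∂(volume.restrict (Ioo (-1 : ℝ) 0)),
      ∫⁻ x in SereginSverak2009.spaceCyl 0 1, ‖v t x‖ₑ ^ 2 ≤ C)
    (hG : ∃ G : ℝ → EuclideanSpace ℝ (Fin 3) → EuclideanSpace ℝ (Fin 3) →L[ℝ] EuclideanSpace ℝ (Fin 3),
      HasWeakSpatialGradientOn (SereginSverak2009.parCylOpens 0 1) v G ∧
      ∫⁻ z in SereginSverak2009.parCyl 0 1, ENNReal.ofReal (frobeniusNormSq (G z.1 z.2)) < ∞)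
    (hq : ∫⁻ z in SereginSverak2009.parCyl 0 1, ‖q z.1 z.2‖ₑ ^ (3 / 2 : ℝ) < ∞)
    {r : ℝ} (hr : 0 < r) (hr1 : r ≤ 1) :
    IsSuitableWeakSolutionInBall r 0 v q := by
  have hQR : parabolicCylinder r (0 : ℝ × EuclideanSpace ℝ (Fin 3)) ⊆ SereginSverak2009.parCyl 0 1 :=
    parabolicCylinder_zero_subset_parCyl hr hr1
  have hleR : parabolicCylinderOpens r (0 : ℝ × EuclideanSpace ℝ (Fin 3)) ≤
      SereginSverak2009.parCylOpens 0 1 := fun w hw => hQR hw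
  have hIsub : Ioo ((0 : ℝ × EuclideanSpace ℝ (Fin 3)).1 - r ^ 2) (0 : ℝ × EuclideanSpace ℝ (Fin 3)).1 ⊆
      Ioo (-1 : ℝ) 0 := by
    intro t ht
    simp only [Prod.fst_zero] at ht
    have : r ^ 2 ≤ 1 := by nlinarith
    exact ⟨by linarith [ht.1], ht.2⟩
  have hBsub : ball ((0 : ℝ × EuclideanSpace ℝ (Fin 3)).2) r ⊆
      SereginSverak2009.spaceCyl (0 : EuclideanSpace ℝ (Fin 3)) 1 := by
    intro x hx
    have hx' : x ∈ ball (0 : EuclideanSpace ℝ (Fin 3)) 1 := ball_subset_ball hr1 hx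
    exact ball_subset_spaceCyl 0 1 hx'
  obtain ⟨G, hGw, hGE⟩ := hG
  refine ⟨hsw.of_le hleR, ?_, ⟨G, hGw.mono hleR, (lintegral_mono_set hQR).trans_lt hGE⟩, ?_⟩
  · obtain ⟨C, hC⟩ := hA
    refine ⟨C, ?_⟩
    filter_upwards [ae_restrict_of_ae_restrict_of_subset hIsub hC] with t ht
    exact (lintegral_mono_set hBsub).trans ht
  · have hpm : AEStronglyMeasurable (uncurry q) (volume.restrict (parabolicCylinder r 0)) :=
      hsw.distributional.2.2.1.aestronglyMeasurable.mono_measure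
        (Measure.restrict_mono (hQR.trans (subset_of_eq (SereginSverak2009.coe_parCylOpens 0 1).symm))
          le_rfl)
    have hfin : ∫⁻ z in parabolicCylinder r 0, ‖uncurry q z‖ₑ ^ (3 / 2 : ℝ) ≠ ∞ :=
      ((lintegral_mono_set hQR).trans_lt hq).ne
    exact (memLp_threeHalves_of_lintegral_le hpm hfin le_rfl).1

/-- **Seregin 2022, §2 Step 4, the concluding appeal to partial regularity** ("According to the
partial regularity theory for the Navier–Stokes equations and to (2.8), the origin `z = 0` is a
regular point of `v`"): for a suitable weak solution of Def. 1.1 in `Q = 𝒞 × ]-1, 0[`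
(the hypothesis block of `seregin2022_logSwirl_regularAtOrigin`), if the scaled cubic functional
`C(R) = R⁻² ∫_{Q(R)} |v|³` (`SereginSverak2009.cubicC 0 R v`, coordinate cylinders) tends to `0` as
`R → 0⁺`, then the origin is a regular point (`SereginSverak2009.IsRegularAtOrigin v`).  Proof (all
inputs proved in the tree): `C_B(r) ≤ C_𝒞(r)` (`cknC_le_cubicC`) is `≤ e` below some `r₀ ≤ 1/2`; the
pressure decay estimate (`seregin_sverak_pressure_decay_holds`) iterated along `θʲr₀`
(`cknD_iterate_le_of_pressure_decay`) makes `D(θᴶr₀)` small; Seregin's Lemma 6.1 at scale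
`s = θᴶr₀` (`seregin2014_lemma61_holds`, `exists_smooth_representative_of_small`) bounds `v` on
`Q_{s/2}(0) ⊇ Q(s/4)`. [cite: Seregin2022LocalAxisym, §2 Step 4, last paragraph (arXiv:2201.00153 p. 7)] -/
theorem isRegularAtOrigin_of_tendsto_cubicC : ∀ (v : ℝ → EuclideanSpace ℝ (Fin 3) → EuclideanSpace ℝ (Fin 3)) (q : ℝ → EuclideanSpace ℝ (Fin 3) → ℝ), IsSuitableWeakSolutionOn (SereginSverak2009.parCylOpens 0 1) 1 0 v q → (∃ C : ℝ≥0, ∀ᵐ t ∂(volume.restrict (Ioo (-1 : ℝ) 0)), ∫⁻ x in SereginSverak2009.spaceCyl 0 1, ‖v t x‖ₑ ^ 2 ≤ C) → (∃ G : ℝ → EuclideanSpace ℝ (Fin 3) → EuclideanSpace ℝ (Fin 3) →L[ℝ] EuclideanSpace ℝ (Fin 3), HasWeakSpatialGradientOn (SereginSverak2009.parCylOpens 0 1) v G ∧ ∫⁻ z in SereginSverak2009.parCyl 0 1, ENNReal.ofReal (frobeniusNormSq (G z.1 z.2)) < ∞) → (∫⁻ z in SereginSverak2009.parCyl 0 1,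 ‖q z.1 z.2‖ₑ ^ (3 / 2 : ℝ) < ∞) → Tendsto (fun R => SereginSverak2009.cubicC 0 R v) (𝓝[>] 0) (𝓝 0) → SereginSverak2009.IsRegularAtOrigin v := by
  intro v q hsw hA hG hq hC
  -- ### constants
  obtain ⟨ε₀, hε₀, c₀, h61⟩ := seregin2014_lemma61_holds
  obtain ⟨c, hPD⟩ := seregin_sverak_pressure_decay_holds.ratio
  obtain ⟨θ, hθ, hθhalf, hcθ⟩ := exists_ratio_mul_le_half c
  have hθ1 : θ ≤ 1 := hθhalf.trans (by norm_num)
  set cθ : ℝ := (c : ℝ) * θ⁻¹ ^ 2 with hcθdef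
  have hcθ0 : 0 ≤ cθ := by positivity
  set e : ℝ := ε₀ / (8 * (cθ + 1)) with hedef
  have he : 0 < e := by positivity
  have he8 : e ≤ ε₀ / 8 :=
    div_le_div_of_nonneg_left hε₀.le (by norm_num) (by nlinarith)
  have hcθe : 2 * (cθ * e) ≤ ε₀ / 4 := by
    have h1 : cθ * e = (cθ / (cθ + 1)) * (ε₀ / 8) := by
      rw [hedef]
      field_simp
    have h2 : cθ / (cθ + 1) ≤ 1 := (div_le_one (by positivity)).2 (by linarith)
    nlinarith
  -- ### `C_B(r) ≤ e` below some `r₀ ≤ 1/2`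
  have hev : ∀ᶠ R in 𝓝[>] (0 : ℝ), SereginSverak2009.cubicC 0 R v < ENNReal.ofReal e :=
    hC (Iio_mem_nhds (ENNReal.ofReal_pos.2 he))
  obtain ⟨u₁, hu₁, hsub⟩ := mem_nhdsGT_iff_exists_Ioo_subset.1 hev
  set r₀ : ℝ := min (u₁ / 2) (1 / 2) with hr₀def
  have hu₁' : 0 < u₁ := hu₁
  have hr₀ : 0 < r₀ := lt_min (by positivity) (by norm_num)
  have hr₀u : r₀ < u₁ := (min_le_left _ _).trans_lt (by linarith)
  have hr₀1 : r₀ ≤ 1 := (min_le_right _ _).trans (by norm_num)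
  have hCsmall : ∀ r : ℝ, 0 < r → r ≤ r₀ →
      cknC r (0 : ℝ × EuclideanSpace ℝ (Fin 3)) v ≤ ENNReal.ofReal e := by
    intro r hr hrr₀
    have hlt : SereginSverak2009.cubicC 0 r v < ENNReal.ofReal e := hsub ⟨hr, hrr₀.trans_lt hr₀u⟩
    exact ((cknC_le_cubicC 0 r v).trans hlt.le)
  -- ### geometry and the distributional solution on `Q`
  have hQ0 : parabolicCylinder r₀ (0 : ℝ × EuclideanSpace ℝ (Fin 3)) ⊆
      (SereginSverak2009.parCylOpens 0 1 : Set (ℝ × EuclideanSpace ℝ (Fin 3))) := by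
    rw [SereginSverak2009.coe_parCylOpens]
    exact parabolicCylinder_zero_subset_parCyl hr₀ hr₀1
  have hdist : IsDistributionalNSSolutionOn (SereginSverak2009.parCylOpens 0 1) 1 0 v q :=
    hsw.distributional
  -- ### `D(r₀) < ∞` and the choice of `J`
  have hD₀ : cknD r₀ (0 : ℝ × EuclideanSpace ℝ (Fin 3)) q < ∞ := by
    rw [cknD]
    refine ENNReal.mul_lt_top (ENNReal.inv_lt_top.2 ?_) ?_
    · exact ENNReal.pow_pos (ENNReal.ofReal_pos.2 hr₀) 2
    · exact (lintegral_mono_set (parabolicCylinder_zero_subset_parCyl hr₀ hr₀1)).trans_lt hq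
  have hε4 : ENNReal.ofReal (ε₀ / 4) ≠ 0 := (ENNReal.ofReal_pos.2 (by positivity)).ne'
  obtain ⟨J, hJ⟩ := ENNReal.exists_inv_two_pow_lt
    ((ENNReal.div_pos_iff).2 ⟨hε4, hD₀.ne⟩).ne'
  have hJ' : (2⁻¹ : ℝ≥0∞) ^ J * cknD r₀ (0 : ℝ × EuclideanSpace ℝ (Fin 3)) q ≤
      ENNReal.ofReal (ε₀ / 4) := ENNReal.mul_le_of_le_div hJ.le
  -- ### the scale `s = θᴶ r₀` and the smallness of `C + D` there
  set s : ℝ := θ ^ J * r₀ with hsdef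
  have hs : 0 < s := by positivity
  have hsr₀ : s ≤ r₀ := mul_le_of_le_one_left hr₀.le (pow_le_one₀ hθ.le hθ1)
  have hs1 : s ≤ 1 := hsr₀.trans hr₀1
  have hDiter := cknD_iterate_le_of_pressure_decay hPD hθ hθ1 hcθ hdist hr₀ hQ0
    (e := ENNReal.ofReal e) (J := J) (fun j _ => hCsmall _ (by positivity)
      (mul_le_of_le_one_left hr₀.le (pow_le_one₀ hθ.le hθ1)))
  have hconst : 2 * ((c : ℝ≥0∞) * ENNReal.ofReal (θ⁻¹ ^ 2) * ENNReal.ofReal e) ≤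
      ENNReal.ofReal (ε₀ / 4) := by
    have e1 : 2 * ((c : ℝ≥0∞) * ENNReal.ofReal (θ⁻¹ ^ 2) * ENNReal.ofReal e) =
        ENNReal.ofReal (2 * (cθ * e)) := by
      rw [hcθdef, ← ENNReal.ofReal_coe_nnreal, ← ENNReal.ofReal_mul (NNReal.coe_nonneg c),
        ← ENNReal.ofReal_mul (by positivity), ← ENNReal.ofReal_ofNat,
        ← ENNReal.ofReal_mul (by norm_num)]
    rw [e1]
    exact ENNReal.ofReal_le_ofReal hcθe
  have hDs : cknD s (0 : ℝ × EuclideanSpace ℝ (Fin 3)) q ≤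
      ENNReal.ofReal (ε₀ / 4) + ENNReal.ofReal (ε₀ / 4) :=
    hDiter.trans (add_le_add hJ' hconst)
  have hCs : cknC s (0 : ℝ × EuclideanSpace ℝ (Fin 3)) v ≤ ENNReal.ofReal e := hCsmall s hs hsr₀
  have hsmall : cknC s (0 : ℝ × EuclideanSpace ℝ (Fin 3)) v + cknD s 0 q < ENNReal.ofReal ε₀ := by
    calc cknC s (0 : ℝ × EuclideanSpace ℝ (Fin 3)) v + cknD s 0 q
        ≤ ENNReal.ofReal e + (ENNReal.ofReal (ε₀ / 4) + ENNReal.ofReal (ε₀ / 4)) :=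
          add_le_add hCs hDs
      _ = ENNReal.ofReal (e + (ε₀ / 4 + ε₀ / 4)) := by
          rw [← ENNReal.ofReal_add (by positivity) (by positivity),
            ← ENNReal.ofReal_add he.le (by positivity)]
      _ < ENNReal.ofReal ε₀ := (ENNReal.ofReal_lt_ofReal_iff hε₀).2 (by linarith)
  -- ### Lemma 6.1 at scale `s`
  have hIB : IsSuitableWeakSolutionInBall s 0 v q :=
    isSuitableWeakSolutionInBall_zero_of_parCyl hsw hA hG hq hs hs1
  obtain ⟨V, hae, -, -, hbd⟩ := exists_smooth_representative_of_small h61 hs hIB hsmall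
  have hVb : ∀ w ∈ parabolicCylinder (s / 2) (0 : ℝ × EuclideanSpace ℝ (Fin 3)),
      ‖uncurry V w‖ ≤ s⁻¹ ^ (0 + 1) * c₀ 0 := by
    intro w hw
    have := hbd 0 w hw
    rwa [norm_iteratedFDeriv_zero] at this
  have hmeas : MeasurableSet (parabolicCylinder (s / 2) (0 : ℝ × EuclideanSpace ℝ (Fin 3))) :=
    (isOpen_parabolicCylinder _ _).measurableSet
  have hbddV : eLpNorm (uncurry V) ∞
      (volume.restrict (parabolicCylinder (s / 2) (0 : ℝ × EuclideanSpace ℝ (Fin 3)))) < ∞ := by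
    rw [eLpNorm_exponent_top]
    exact eLpNormEssSup_lt_top_of_ae_bound ((ae_restrict_iff' hmeas).2 (Eventually.of_forall hVb))
  have hbdd : eLpNorm (uncurry v) ∞
      (volume.restrict (parabolicCylinder (s / 2) (0 : ℝ × EuclideanSpace ℝ (Fin 3)))) < ∞ := by
    rwa [eLpNorm_congr_ae hae]
  -- ### shrink to a coordinate cylinder `Q(s/4) ⊆ Q_{s/2}(0)`
  refine ⟨s / 4, by positivity, lt_of_le_of_lt (eLpNorm_mono_measure _ (Measure.restrict_mono ?_ le_rfl)) hbdd⟩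
  refine (parCyl_subset_parabolicCylinder 0 (by positivity : (0 : ℝ) ≤ s / 4)).trans
    (parabolicCylinder_mono (by positivity) ?_ 0)
  have h2 : Real.sqrt 2 ≤ 2 := by
    rw [Real.sqrt_le_iff]
    norm_num
  nlinarith [Real.sqrt_nonneg 2]

end Summit.NavierStokesRegularity.NavierStokesRegularity.Theorems.AxisymmetricKatoGlobal.EulerScaling

end
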